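import Mathlib
import HarnessLib
import Summits.CriticalPhenomena.PercolationContinuityZ3.Theses.PercNonProliferation

/-!
# Sketch — crux-ideate stmt-CriticalPhenomena-4447 (`FreeBoxPowerSaving`, route PercNonProliferation r5),
# round 1, ideator 1

First lemmas of the two crux idea cards, stated over existing declarations (statements only; they
must elaborate, proofs are for the crux-plan / prover stages).

* Card 1 `tightness-collapse-typical-kmax`: Hutchcroft's BK size-multiplicativity
  (arXiv:2008.11197, Thm 2.3, valid on ANY finite graph, here the free box `Λ_n = box 3 n`)
  makes the power saving EQUIVALENT to a constant-probability statement: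
  "quasi-giants (in-box clusters with `≥ n^{3-a}` vertices) are not asymptotically almost sure".
* Card 2 `boundary-interior-split-fat-finite-clusters`: the free-box second moment splits EXACTLY
  into boundary-touching pieces (all jump-world content) and interior clusters (= full `ℤ³`-clusters
  confined to the box: a jump-free "fat finite cluster" bound, weaker than bulk ball decay).
* Combined line: quasi-giants not a.s. ⟸ (boundary quasi-giants not a.s.) ∧ (fat finite clusters
  polynomially rare).
-/

namespace Summit.CriticalPhenomena.PercolationContinuityZ3.Cruxes.FreeBoxPowerSaving.SketchIdeator1

open scoped Classical
open Literature.Probability.Percolation Literature.Probability.LatticeModels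

/-- Critical bond percolation measure on `ℤ³`. -/
noncomputable abbrev μc : MeasureTheory.Measure (BondConfig (Site 3)) :=
  bondPercolation (zdGraph 3) (criticalProbI 3)

/-- `|C_{Λ_n}(u)|`: number of sites of the free box `Λ_n = box 3 n` joined to `u` by an open path
inside `Λ_n` (in-box cluster size; `0` if `u ∉ Λ_n`). -/
noncomputable def inBoxSize (n : ℕ) (u : Site 3) (ω : BondConfig (Site 3)) : ℕ :=
  ((box 3 n).filter fun v => ω ∈ openConnIn (↑(box 3 n)) u v).card

/-- The quasi-giant event `{|K_max^free(Λ_n)| ≥ s}`: some in-box cluster of `Λ_n` has at least `s`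
vertices. -/
def quasiGiant (n : ℕ) (s : ℝ) : Set (BondConfig (Site 3)) :=
  {ω | ∃ u ∈ box 3 n, s ≤ (inBoxSize n u ω : ℝ)}

/-- The same event restricted to clusters touching the inner vertex boundary `∂ⁱⁿΛ_n`. -/
def boundaryQuasiGiant (n : ℕ) (s : ℝ) : Set (BondConfig (Site 3)) :=
  {ω | ∃ u ∈ innerBoundary (zdGraph 3) (box 3 n), s ≤ (inBoxSize n u ω : ℝ)}

/-! ### Card 1 — tightness collapse -/

/-- NAMED FACT to vendor (Hutchcroft, PTRF 181 (2021), arXiv:2008.11197, Thm 2.3, first display,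
specialised to the finite graph `Λ_n ⊂ ℤ³` with `Λ = V(Λ_n)`; proof there = the combinatorial
divide-and-conquer Lemma 2.4 on a spanning tree + the BK inequality, both finitary):
`P(|K_max(Λ_n)| ≥ 3^k λ) ≤ P(|K_max(Λ_n)| ≥ λ)^{3^{k-1}+1}` for all `p`, `n`, `λ ≥ 1`, `k ≥ 1`. -/
def BKSizeMultiplicativity : Prop :=
  ∀ (p : unitInterval) (n k : ℕ) (lam : ℝ), 1 ≤ lam → 1 ≤ k →
    (bondPercolation (zdGraph 3) p).real (quasiGiant n (3 ^ k * lam))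
      ≤ ((bondPercolation (zdGraph 3) p).real (quasiGiant n lam)) ^ (3 ^ (k - 1) + 1)

/-- `QG-NAS(a, ε)`: quasi-giants of size `n^{3-a}` are NOT asymptotically almost sure in the critical
free box — with probability at least `ε`, eventually in `n`, every in-box cluster of `Λ_n` has fewer
than `n^{3-a}` vertices. (The transfer `C⁺` of card 1.) -/
def QuasiGiantNotAlmostSure : Prop :=
  ∃ a ε : ℝ, 0 < a ∧ 0 < ε ∧ ∃ n₀ : ℕ, ∀ n : ℕ, n₀ ≤ n →
    μc.real (quasiGiant n ((n : ℝ) ^ (3 - a))) ≤ 1 - ε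

/-- CARD 1, first lemma (provable now from the vendored fact): BK size-multiplicativity boosts
"not almost sure at threshold `n^{3-a}`" to `P(|K_max| ≥ C (log n) n^{3-a}) ≤ n^{-9}`
(take `3^{k-1} ≈ (9/ε) log n`), whence `E|K_max^free(Λ_n)| ≤ C' (log n) n^{3-a}` and, by
`FA₂ ≤ E|K_max|/|Λ_n|`, the crux with any exponent `a' < a`. -/
def FirstLemma1 : Prop :=
  BKSizeMultiplicativity → QuasiGiantNotAlmostSure →
    Summit.CriticalPhenomena.PercolationContinuityZ3.Theses.PercNonProliferation.FreeBoxPowerSaving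

/-- CARD 1, converse (elementary, provable now): the crux with exponent `a` gives
`(E|K_max|)² ≤ |Λ_n|² FA₂(n) ≤ C |Λ_n|² n^{-a}`, so by Markov `P(|K_max| ≥ 2√C |Λ_n| n^{-a/2}) ≤ 1/2`,
i.e. `QG-NAS(a/2 - o(1), 1/2)`. Together with `FirstLemma1`: the crux IS a constant-probability
statement, up to a factor `2` in the exponent. -/
def FirstLemma1_converse : Prop :=
  Summit.CriticalPhenomena.PercolationContinuityZ3.Theses.PercNonProliferation.FreeBoxPowerSaving →
    QuasiGiantNotAlmostSure

/-! ### Card 2 — boundary / interior split -/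

/-- `BoundaryPieceBound a`: the boundary-touching part of the free-box pair sum has a power saving:
`|Λ_n|⁻² Σ_{x,y∈Λ_n} P_{p_c}(x ↔ y in Λ_n, C_{Λ_n}(x) ∩ ∂ⁱⁿΛ_n ≠ ∅) ≤ C n^{-a}`. All jump-world
(monolithic-branch) content of the crux lives here: an in-box piece of the infinite cluster touches
`∂ⁱⁿΛ_n`. -/
def BoundaryPieceBound (a : ℝ) : Prop :=
  ∃ C : ℝ, ∀ n : ℕ, 1 ≤ n →
    (∑ x ∈ box 3 n, ∑ y ∈ box 3 n,
        μc.real (openConnIn (↑(box 3 n)) x y ∩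
          {ω | ∃ z ∈ innerBoundary (zdGraph 3) (box 3 n), ω ∈ openConnIn (↑(box 3 n)) x z}))
      / ((box 3 n).card : ℝ) ^ 2 ≤ C * (n : ℝ) ^ (-a)

/-- `FatFiniteClusterBound a` (jump-free, bulk): the expected size of the cluster of the origin
RESTRICTED TO CLUSTERS CONFINED TO `B(0,2n)` grows slower than volume:
`E_{p_c}[|C(0)| ; C(0) ⊆ Λ_{2n}] ≤ C n^{3-a}`. It bounds the interior part of the pair sum
(an interior in-box cluster of `Λ_n` is a full `ℤ³`-cluster confined to `x + Λ_{2n}`); it is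
implied by the bulk ball decay `Σ_{y∈Λ_{2n}} τ_{p_c}(0,y) ≤ C n^{3-a}` (PercTwoPointDecay's X_A) and,
unlike X_A, holds in every jump world whose FINITE critical clusters are thin. -/
def FatFiniteClusterBound (a : ℝ) : Prop :=
  ∃ C : ℝ, ∀ n : ℕ, 1 ≤ n →
    (∑ y ∈ box 3 (2 * n), μc.real (openConn 0 y ∩ {ω | openCluster ω 0 ⊆ ↑(box 3 (2 * n))}))
      ≤ C * (n : ℝ) ^ (3 - a)

/-- CARD 2, first lemma (provable now, measure-theoretic bookkeeping): the exact split
`Σ_C |C|² = Σ_{C touches ∂ⁱⁿΛ_n} |C|² + Σ_{x} |C(x)| 1{C_{Λ_n}(x) misses ∂ⁱⁿΛ_n}`, the a.e. identity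
`C_{Λ_n}(x) = C(x)` for interior clusters (configurations `ω ⊆ E(ℤ³)`, `setBernoulli_ae_subset`),
translation invariance (`bondPercolation_real_preimage_shift`) and `Λ_n ⊆ x + Λ_{2n}` give
`FA₂(n) ≤ (boundary part) + |Λ_n|⁻¹ E[|C(0)|; C(0) ⊆ Λ_{2n}] ≤ C n^{-a} + C' n^{3-a}/(2n+1)³`. -/
def FirstLemma2 : Prop :=
  ∀ a : ℝ, 0 < a → BoundaryPieceBound a → FatFiniteClusterBound a →
    Summit.CriticalPhenomena.PercolationContinuityZ3.Theses.PercNonProliferation.FreeBoxPowerSaving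

/-! ### Combined line (cards 1 + 2) -/

/-- `FatClusterRarity a`: fat confined critical clusters are polynomially rare,
`n^{a} · P_{p_c}(|C(0) ∩ Λ_{2n}| ≥ n^{3-a} ∧ C(0) ⊆ Λ_{2n}) → 0` — exactly what makes the interior
of `Λ_n` free of `n^{3-a}`-clusters with probability `→ 1` (first moment over the `≤ 27 n^{a}`
disjoint candidates). -/
def FatClusterRarity (a : ℝ) : Prop :=
  Filter.Tendsto (fun n : ℕ => (n : ℝ) ^ a *
      μc.real {ω | (n : ℝ) ^ (3 - a) ≤ (((box 3 (2 * n)).filter fun y => ω ∈ openConn 0 y).card : ℝ) ∧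
        openCluster ω 0 ⊆ ↑(box 3 (2 * n))})
    Filter.atTop (nhds 0)

/-- `BoundaryQuasiGiantNotAS a ε`: with probability `≥ ε`, eventually, no in-box cluster of `Λ_n`
touching `∂ⁱⁿΛ_n` has `≥ n^{3-a}` vertices (the anti-monolithic half in constant-probability form:
by card 1 no rate is needed here). -/
def BoundaryQuasiGiantNotAS (a ε : ℝ) : Prop :=
  ∃ n₀ : ℕ, ∀ n : ℕ, n₀ ≤ n → μc.real (boundaryQuasiGiant n ((n : ℝ) ^ (3 - a))) ≤ 1 - ε

/-- COMBINED first lemma (provable now given the vendored fact): a union bound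
`quasiGiant ⊆ boundaryQuasiGiant ∪ {some interior cluster ≥ n^{3-a}}` and the first-moment bound
for interior fat clusters reduce `QG-NAS` — hence the crux — to the two halves. -/
def FirstLemma3 : Prop :=
  BKSizeMultiplicativity →
    ∀ a ε : ℝ, 0 < a → 0 < ε → BoundaryQuasiGiantNotAS a ε → FatClusterRarity a →
      Summit.CriticalPhenomena.PercolationContinuityZ3.Theses.PercNonProliferation.FreeBoxPowerSaving

end Summit.CriticalPhenomena.PercolationContinuityZ3.Cruxes.FreeBoxPowerSaving.SketchIdeator1
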